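import Summits.BirchSwinnertonDyer.BirchSwinnertonDyer.Theorems.CumulativeHeegnerLeopoldtCumulativeHeegnerInclusionAtThreeStubResidualSelmerFiniteDevissageNamed
import Summits.BirchSwinnertonDyer.BirchSwinnertonDyer.Theorems.CumulativeHeegnerLeopoldtCumulativeHeegnerInclusionAtThreeStubResidualSelmerFiniteNamed
import Literature.NumberTheory.EllipticCurves.GoodReductionUnramifiedProofs
import HarnessLib

/-!
# Route `CumulativeHeegnerLeopoldt`, crux K1 `CumulativeHeegnerInclusionAtThree` (stmt-BirchSwinnertonDyer-24198),
# line `birth` v3, STUB B1: the dévissage for `E[p]` itself — hypothesis (U) discharged by good reduction,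
# and the per-frame closer «character data ⟹ `Sel_𝔭(K_∞, E[p^∞])[p]` finite»

Fifth brick for stub B1, assembling the previous two (`…DevissageNamed`: dévissage of the Greenberg–Vatsal residual
Selmer group `R_𝔭^Σ(L, ·)` under local injectivity (U), (S); `…Named`: `R_𝔭^{Σ_bad}(K_∞, E[p])` finite ⟹
`Sel_𝔭(K_∞, E[p^∞])[p]` finite for `K` imaginary quadratic) for the coefficient module `B = E[p]` of an elliptic
curve `E/K`:

* `inertiaIn_smul_geomTorsion_eq` — (U) for `E[p]`: at a place `v ∤ p` of good reduction the inertia group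
  `H ⊓ I_v` acts trivially on `E[p]` (Silverman VII.4.1, tree `smul_geomTorsion_eq_of_mem_inertia`, with the
  identification of `I_v` as the inertia group of the prime `𝔓₀` cut out by the chosen embedding,
  `inertia_adicCompletionPrime_eq_map_absInertia`);
* **`finite_residualSelmer_geomTorsion_of_devissage`** — for `Σ ⊇` the bad places prime to `p` and ANY
  `Γ_K`-equivariant exact `0 → A —j→ E[p] —q→ C → 0` of discrete `Γ_K`-modules with `C^{H ⊓ D_𝔭} = 0`:
  `R_𝔭^Σ(L, A)`, `R_𝔭^Σ(L, C)` finite ⟹ `R_𝔭^Σ(L, E[p])` finite;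
* **`finite_selmerAc_empty_pTorsion_of_devissage`** — the PER-FRAME CLOSER for B1: `K` imaginary quadratic,
  `κ` any `ℤ_p`-extension, `𝔭 ∋ p`; given such a dévissage datum with `C^{ker κ ⊓ D_𝔭} = 0` and the two
  finiteness inputs for `Σ_bad = {v ∤ p bad}`, Castella's `Sel_𝔭(K_∞, E[p^∞])[p]` is finite.

For B1 on the Leopoldt cell the intended datum is `A = Φ_K` (the rational line, base-changed), `C = E[3]/Φ_K`
(`≅ 𝔽₃(ψ)`, on which `G_{K_{∞,𝔭′}}` acts through `ψ|_{G_{ℚ₃}} ≠ 1` by the non-anomalous clause, so (S) holds),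
and the two inputs are the character statements of CGLS 2022 Thm. 11 (Rubin's main conjecture + μ = 0;
Oukhaba–Viguié 2016 at `p = 3`) — neither the modules nor the character facts are in the tree yet.
THEOREMS ONLY (`--supports stmt-BirchSwinnertonDyer-24198`); no definition, no named fact, no `sorry`;
route-independent imports. Seat bsd-line-chl-k1-p1-w2 (width, stub B1). BSD is not proved by any of this.

References: [CastellaGrossiLeeSkinner2022] Prop. 17–18, Thm. 11 (arXiv:2008.02571 §1); [SilvermanAEC2009] VII.4.1;
[GreenbergVatsal2000] §2; [NeukirchANT1999] II (9.6).
-/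

set_option autoImplicit false
set_option linter.dupNamespace false

noncomputable section

open scoped Classical

namespace Summit.BirchSwinnertonDyer.BirchSwinnertonDyer.Theorems.CumulativeHeegnerInclusionAtThreeStubB1DevissageCurve

open Literature.NumberTheory.EllipticCurves Literature.NumberTheory.EllipticCurves.GreenbergSelmer
  Literature.NumberTheory.EllipticCurves.GreenbergVatsal2000 Literature.NumberTheory.GaloisRepresentations
  NumberField IsDedekindDomain Field WeierstrassCurve
  Summit.BirchSwinnertonDyer.Rank1Residual.X11b Summit.BirchSwinnertonDyer.Rank1Residual.X11b.AcSelmer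
  Summit.BirchSwinnertonDyer.BirchSwinnertonDyer.Theorems.CumulativeHeegnerInclusionAtThreeStubB1DevissageNamed
  Summit.BirchSwinnertonDyer.BirchSwinnertonDyer.Theorems.CumulativeHeegnerInclusionAtThreeStubB1Named

variable {K : Type} [Field K] [NumberField K] (W : WeierstrassCurve K) [W.IsElliptic] (p : ℕ)

/-- **(U) for `E[p]`: at a good place `v ∤ p` the inertia group `H ⊓ I_v` acts trivially on `E[p]`**
(`I_v` = inertia group of the prime `𝔓₀` above `v` cut out by the chosen embedding).
[cite: SilvermanAEC2009, Prop. VII.4.1(a)] [cite: NeukirchANT1999, Ch. II §9 Prop. (9.6)] -/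
theorem inertiaIn_smul_geomTorsion_eq (H : Subgroup (absoluteGaloisGroup K)) {v : HeightOneSpectrum (𝓞 K)}
    (hv : W.HasGoodReductionAt v) (hpv : ((p : ℕ) : 𝓞 K) ∉ v.asIdeal)
    (τ : inertiaIn H v) (P : W.geomTorsion (p : ℤ)) : τ • P = P := by
  have hτI : ((τ : decomp (K := K) v) : absoluteGaloisGroup K) ∈ inertia v :=
    ((mem_inertiaIn_iff H v _).1 τ.2).2
  have hI𝔓 : ((τ : decomp (K := K) v) : absoluteGaloisGroup K) ∈
      (adicCompletionPrime K v).inertia (absoluteGaloisGroup K) := by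
    rw [inertia_adicCompletionPrime_eq_map_absInertia]; exact hτI
  have hn : (((p : ℤ) : 𝓞 K)) ∉ v.asIdeal := by exact_mod_cast hpv
  exact W.smul_geomTorsion_eq_of_mem_inertia hv hn (adicCompletionPrime_mem_primesAbove K v) hI𝔓 P

variable {A : Type} [AddCommGroup A] [DistribMulAction (absoluteGaloisGroup K) A] [TopologicalSpace A]
  [DiscreteTopology A]
variable {C : Type} [AddCommGroup C] [DistribMulAction (absoluteGaloisGroup K) C] [TopologicalSpace C]
  [DiscreteTopology C]

/-- **Dévissage for `R_𝔭^Σ(L, E[p])`**: for `Σ` containing every bad place prime to `p` and a `Γ_K`-equivariant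
exact `0 → A —j→ E[p] —q→ C → 0` of discrete `Γ_K`-modules with `C^{H ⊓ D_𝔭} = 0`, the finiteness of
`R_𝔭^Σ(L, A)` and `R_𝔭^Σ(L, C)` implies that of `R_𝔭^Σ(L, E[p])` ((U) by `inertiaIn_smul_geomTorsion_eq`, (S) by
`C^{H ⊓ D_𝔭} = 0`; `finite_datumStrictSelmer_of_devissage_of_unramified_of_fixed`).
[cite: CastellaGrossiLeeSkinner2022, Prop. 17 (arXiv:2008.02571 §1.4)] [cite: SilvermanAEC2009, Prop. VII.4.1(a)] -/
theorem finite_residualSelmer_geomTorsion_of_devissage (H : Subgroup (absoluteGaloisGroup K)) [H.Normal]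
    (𝔭 : HeightOneSpectrum (𝓞 K)) {S₀ : Set (HeightOneSpectrum (𝓞 K))}
    (hS₀ : ∀ v : HeightOneSpectrum (𝓞 K), v ∉ S₀ → ((p : ℕ) : 𝓞 K) ∉ v.asIdeal → W.HasGoodReductionAt v)
    (j : A →+ W.geomTorsion (p : ℤ)) (hj' : ∀ (σ : absoluteGaloisGroup K) (a : A), j (σ • a) = σ • j a)
    (hinj : Function.Injective j)
    (q : W.geomTorsion (p : ℤ) →+ C)
    (hq' : ∀ (σ : absoluteGaloisGroup K) (b : W.geomTorsion (p : ℤ)), q (σ • b) = σ • q b)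
    (hqj : ∀ a : A, q (j a) = 0) (hsurj : Function.Surjective q)
    (hexact : ∀ b : W.geomTorsion (p : ℤ), q b = 0 → ∃ a : A, j a = b)
    (hfix : ∀ c : C, (∀ g : ↥(H ⊓ decomp 𝔭), g • c = c) → c = 0)
    (hA : (datumStrictSelmer H A p (AcSelmer.bdpData A p 𝔭) S₀ : Set (subgroupH1 H A)).Finite)
    (hC : (datumStrictSelmer H C p (AcSelmer.bdpData C p 𝔭) S₀ : Set (subgroupH1 H C)).Finite) :
    (datumStrictSelmer H (W.geomTorsion (p : ℤ)) p (AcSelmer.bdpData _ p 𝔭) S₀ :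
      Set (subgroupH1 H (W.geomTorsion (p : ℤ)))).Finite := by
  haveI : ContinuousSMul (absoluteGaloisGroup K) (W.geomTorsion (p : ℤ)) :=
    W.continuousSMul_geomTorsion (W.isOpen_stabilizer_point_holds) _
  have hcont : ∀ b : W.geomTorsion (p : ℤ), Continuous fun g : absoluteGaloisGroup K ↦ g • b := fun b ↦
    continuous_id.smul continuous_const
  exact finite_datumStrictSelmer_of_devissage_of_unramified_of_fixed H p 𝔭 S₀ j hj' hinj q hq' hqj hsurj
    hexact hcont (fun v hvS hvp τ b ↦ inertiaIn_smul_geomTorsion_eq W p H (hS₀ v hvS hvp) hvp τ b) hfix hA hC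

/-- **PER-FRAME CLOSER FOR STUB B1.** `K` imaginary quadratic, `κ` any `ℤ_p`-extension (`K_∞ = K̄^{ker κ}`),
`𝔭 ∋ p`, `Σ_bad` = the bad places of `E/K` prime to `p`. Given a `Γ_K`-equivariant exact
`0 → A —j→ E[p] —q→ C → 0` of discrete `Γ_K`-modules with `C^{ker κ ⊓ D_𝔭} = 0` (for `C = E[p]/Φ ≅ 𝔽_p(ψ)`: `ψ`
non-trivial on `G_{K_{∞,𝔭}}` — the non-anomalous clause) such that the residual groups `R_𝔭^{Σ_bad}(K_∞, A)` and
`R_𝔭^{Σ_bad}(K_∞, C)` are finite (for characters: CGLS Thm. 11), Castella's `Sel_𝔭(K_∞, E[p^∞])[p]` is finite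
— i.e. the conclusion of B1 at that frame. [cite: CastellaGrossiLeeSkinner2022, Prop. 17–18 and Thm. 11 (arXiv:2008.02571 §1)] [cite: GreenbergVatsal2000, §2 Prop. (2.8)] -/
theorem finite_selmerAc_empty_pTorsion_of_devissage [Fact p.Prime] (hK : IsImaginaryQuadratic K)
    (κ : ZpExtension K p)
    {𝔭 : HeightOneSpectrum (𝓞 K)} (h𝔭 : ((p : ℕ) : 𝓞 K) ∈ 𝔭.asIdeal)
    (j : A →+ W.geomTorsion (p : ℤ)) (hj' : ∀ (σ : absoluteGaloisGroup K) (a : A), j (σ • a) = σ • j a)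
    (hinj : Function.Injective j)
    (q : W.geomTorsion (p : ℤ) →+ C)
    (hq' : ∀ (σ : absoluteGaloisGroup K) (b : W.geomTorsion (p : ℤ)), q (σ • b) = σ • q b)
    (hqj : ∀ a : A, q (j a) = 0) (hsurj : Function.Surjective q)
    (hexact : ∀ b : W.geomTorsion (p : ℤ), q b = 0 → ∃ a : A, j a = b)
    (hfix : ∀ c : C, (∀ g : ↥(κ.kerSubgroup ⊓ decomp 𝔭), g • c = c) → c = 0)
    (hA : (datumStrictSelmer κ.kerSubgroup A p (AcSelmer.bdpData A p 𝔭)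
        {v : HeightOneSpectrum (𝓞 K) | ¬ W.HasGoodReductionAt v ∧ ((p : ℕ) : 𝓞 K) ∉ v.asIdeal} :
        Set (subgroupH1 κ.kerSubgroup A)).Finite)
    (hC : (datumStrictSelmer κ.kerSubgroup C p (AcSelmer.bdpData C p 𝔭)
        {v : HeightOneSpectrum (𝓞 K) | ¬ W.HasGoodReductionAt v ∧ ((p : ℕ) : 𝓞 K) ∉ v.asIdeal} :
        Set (subgroupH1 κ.kerSubgroup C)).Finite) :
    Set.Finite {s : selmerAc W p κ 𝔭 ∅ | p • s = 0} := by
  have hS₀ : ∀ v : HeightOneSpectrum (𝓞 K),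
      v ∉ {v : HeightOneSpectrum (𝓞 K) | ¬ W.HasGoodReductionAt v ∧ ((p : ℕ) : 𝓞 K) ∉ v.asIdeal} →
        ((p : ℕ) : 𝓞 K) ∉ v.asIdeal → W.HasGoodReductionAt v := by
    intro v hv hpv
    by_contra hbad
    exact hv ⟨hbad, hpv⟩
  exact finite_selmerAc_empty_pTorsion_of_isImaginaryQuadratic W κ hK h𝔭 hS₀
    (finite_residualSelmer_geomTorsion_of_devissage W p κ.kerSubgroup 𝔭 hS₀ j hj' hinj q hq' hqj hsurj
      hexact hfix hA hC)

end Summit.BirchSwinnertonDyer.BirchSwinnertonDyer.Theorems.CumulativeHeegnerInclusionAtThreeStubB1DevissageCurve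

end
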